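import Summits.QuantumFields.BalabanUV.Beta.GAN24.ExchangeESectorValue

/-!
# `BalabanUV.Beta.GAN24.ExchangeESectorPattern` — binder row G-an2-4 ∕ (CONV-C), W-slot (α-0), ROW (C) AT LEVELS `j ≥ 1`: **THE PATTERN TABLE OF THE E-SECTOR EE WORD IS
# «ANTISYMMETRIC PAIR ⊗ ANTISYMMETRIC PAIR, SYMMETRIC UNDER THE PAIR SWAP»** — with `P(μα;νβ) := Σ_{x∈box} Σ_b q_{μα}(b,x)·(E2_{j+1} q_{νβ})(b,x)` (the scalar of
# `ExchangeESectorValue.exchangeWord_sector_value`): `P(μα;νβ) = P(νβ;μα)` (cell adjointness + reciprocity of `E2`), `P(μα;νβ) = −P(μα;βν)` and `P(μα;νβ) = −P(αμ;νβ)` (`μ ≠ α`, `ν ≠ β`;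
# the `E2`-images of `q_{νβ}` and `q_{βν}` are opposite — `StaircaseCurrentAntisymm`), hence the word itself: `W(μ,α;ν,β) = −W(μ,α;β,ν) = −W(α,μ;ν,β)`, `W = 0` on the diagonals
# (every `j`, every `d`, in-block root, all units) (G-an2-4 CRUX TEAM (2), seat `b2b-balaban-gan24-formalise-leaf-06` = the (γ) hand, gen 53; journal INTENT I-leaf06-g53-7)

NOT IN PRINT; OUR BOOKKEEPING ([folklore] BY NAME: gen 53's `ExchangeESectorValue.exchangeWord_sector_value`, `StaircaseCurrentPeriodic.stairFace_eq_periodic ∕ qProfile_translate ∕ abs_qProfile_le`,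
`StaircaseCurrentAntisymm.stairFace_antisymm`, `ValueHessianFirstMoment.E2_swap`, and gen 52's (W6)-a `ValueHessianCellAdjoint.sum_box_E2apply_mul_periodic`; 0 `def`, 0 cited fact, 0 `def … : Prop`,
0 sorry).
HONEST FRAMING (cell contract, verbatim): «discharging `BetaPertH` makes Bałaban's UV stability UNCONDITIONAL — a real constructive-QFT result; it is NOT the continuum
limit and NOT the Clay problem.»  HONEST DEPENDENCY (verbatim): «continuum YM on T⁴ ⇐ BetaPertH ∧ nine spine estimates (0/9 proved); BetaPertH ⇐ (D1) ∧ (D4) ∧ CAP+tail;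
G-an2-4 gates asym, D1 and NE2/3/4.»

WHY (memo `g52/C-LEVELS-GE1.md` §21: road-P2 g47 R-2 reads (C)_{j≥1} through the `|A∧a|²` tensor `−u_j·[δ_{μν}δ_{αβ} − ½(δ_{μα}δ_{νβ} + δ_{μβ}δ_{να})]`).  A four-index table that is
antisymmetric in `(μ,α)`, antisymmetric in `(ν,β)` and symmetric under `(μα) ↔ (νβ)` is a symmetric bilinear form on 2-forms; at `d+1 = 2` it is ONE scalar (`P(01;01)`), and the
symmetrised word `W(μ,α;ν,β) + W(ν,α;μ,β)` is then exactly the `|A∧a|²` pattern (`EX(0011) = 2P`, `EX(0101) = −P`: the engine's `−2 : 1`, E-leaf06-g53-1).  At `d+1 ≥ 3` the reduction to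
one scalar per level needs the hypercubic covariance of `E2_{j+1}` ∕ `G_{j+1}` under axis PERMUTATIONS (not typed here; the consumer may not need it).
* §1 `tsum_E2_qProfile_antisymm` (the `E2`-image of `q_{νβ}` is minus that of `q_{βν}`), **`pairing_swap`**, **`pairing_antisymm_right`**, **`pairing_antisymm_left`**.
Asserts NO value of Bałaban's tables; discharges NOTHING of (C) ∕ (C)sym ∕ (Q-L) ∕ «T2Shape» ∕ «T2Drift» ∕ (hW, hWall); NEVER «G-an2-4 closed» as (CONV-C); NOT D1, NOT `BetaPertH`,
NOT continuum, NOT Clay.  2026-08-23; no existing file touched.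
-/

noncomputable section

open Finset
open scoped BigOperators
open Literature.MathematicalPhysics.QuantumFieldTheory
open Literature.MathematicalPhysics.QuantumFieldTheory.Balaban1983to89
open Literature.MathematicalPhysics.QuantumFieldTheory.Balaban1983to89.Beta
open ExpKernelCalculus (Site MKer)
open AffineAveraging (box toSite)
open OneStepResolventKernel (Fib)
open BalabanStepJetsSucc (E2)
open Summit.QuantumFields.BalabanUV.Beta.AxialDressingRooted (one_le_of_neZero)
open Summit.QuantumFields.BalabanUV.Beta.GAN24.ValueHessianCellAdjoint (sum_box_E2apply_mul_periodic)
open Summit.QuantumFields.BalabanUV.Beta.GAN24.ValueHessianFirstMoment (E2_swap)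
open Summit.QuantumFields.BalabanUV.Beta.GAN24.StaircaseCurrentAntisymm (stairFace_antisymm)
open Summit.QuantumFields.BalabanUV.Beta.GAN24.StaircaseCurrentPeriodic (stairFace_eq_periodic qProfile_translate abs_qProfile_le)

namespace Summit.QuantumFields.BalabanUV.Beta.GAN24.ExchangeESectorPattern

variable {d : ℕ} {Lc : ℕ} [NeZero Lc]

/-! ## §1 The pattern table -/

/-- [folklore] **THE VALUE-HESSIAN IMAGES OF `q_{νβ}` AND `q_{βν}` ARE OPPOSITE** (`ν ≠ β`): `Σ'_s Σ_{b′} E2_{j+1}(z,s)_{bb′}·q_{νβ}(b′,s) = −Σ'_s Σ_{b′} E2_{j+1}(z,s)_{bb′}·q_{βν}(b′,s)`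
(both are the staircase currents, which are antisymmetric in (background, leg)). -/
theorem tsum_E2_qProfile_antisymm (j : ℕ) {ν β : Fin (d + 1)} (hνβ : ν ≠ β) (z : Site (d + 1)) (b : Fin (d + 1)) :
    ∑' s : Site (d + 1), ∑ b' : Fin (d + 1), E2 d Lc (j + 1) z s (Sum.inl b) (Sum.inl b') *
        ((if b' = ν then ((Lc : ℝ)⁻¹ * (Lc : ℝ)⁻¹) * ((((s β % (Lc : ℤ) : ℤ) : ℝ) - ((Lc : ℝ) - 1) / 2)) else 0)
          + (if b' = β then (-(Lc : ℝ)⁻¹ * ((((s ν % (Lc : ℤ) : ℤ) : ℝ) - ((Lc : ℝ) - 1) / 2))) * (if s β % (Lc : ℤ) = (Lc : ℤ) - 1 then (1 : ℝ) else 0) else 0)) =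
      -∑' s : Site (d + 1), ∑ b' : Fin (d + 1), E2 d Lc (j + 1) z s (Sum.inl b) (Sum.inl b') *
        ((if b' = β then ((Lc : ℝ)⁻¹ * (Lc : ℝ)⁻¹) * ((((s ν % (Lc : ℤ) : ℤ) : ℝ) - ((Lc : ℝ) - 1) / 2)) else 0)
          + (if b' = ν then (-(Lc : ℝ)⁻¹ * ((((s β % (Lc : ℤ) : ℤ) : ℝ) - ((Lc : ℝ) - 1) / 2))) * (if s ν % (Lc : ℤ) = (Lc : ℤ) - 1 then (1 : ℝ) else 0) else 0)) := by
  rw [← stairFace_eq_periodic (Lc := Lc) j hνβ z b, ← stairFace_eq_periodic (Lc := Lc) j (Ne.symm hνβ) z b]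
  have h := stairFace_antisymm (Lc := Lc) j hνβ z b
  linarith

/-- [folklore] **THE PATTERN TABLE IS SYMMETRIC UNDER THE PAIR SWAP**: `Σ_{x∈box}Σ_b q_{μα}(b,x)·(E2_{j+1} q_{νβ})(b,x) = Σ_{x∈box}Σ_b q_{νβ}(b,x)·(E2_{j+1} q_{μα})(b,x)`
(cell adjointness `ValueHessianCellAdjoint.sum_box_E2apply_mul_periodic` on the bounded periodic profiles, then reciprocity `E2_swap`). -/
theorem pairing_swap (j : ℕ) (μ α ν β : Fin (d + 1)) :
    ∑ x ∈ box (d + 1) Lc, ∑ b : Fin (d + 1),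
        ((if b = μ then ((Lc : ℝ)⁻¹ * (Lc : ℝ)⁻¹) * ((((toSite x α % (Lc : ℤ) : ℤ) : ℝ) - ((Lc : ℝ) - 1) / 2)) else 0)
          + (if b = α then (-(Lc : ℝ)⁻¹ * ((((toSite x μ % (Lc : ℤ) : ℤ) : ℝ) - ((Lc : ℝ) - 1) / 2))) * (if toSite x α % (Lc : ℤ) = (Lc : ℤ) - 1 then (1 : ℝ) else 0) else 0)) *
        ∑' s : Site (d + 1), ∑ b' : Fin (d + 1), E2 d Lc (j + 1) (toSite x) s (Sum.inl b) (Sum.inl b') *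
          ((if b' = ν then ((Lc : ℝ)⁻¹ * (Lc : ℝ)⁻¹) * ((((s β % (Lc : ℤ) : ℤ) : ℝ) - ((Lc : ℝ) - 1) / 2)) else 0)
            + (if b' = β then (-(Lc : ℝ)⁻¹ * ((((s ν % (Lc : ℤ) : ℤ) : ℝ) - ((Lc : ℝ) - 1) / 2))) * (if s β % (Lc : ℤ) = (Lc : ℤ) - 1 then (1 : ℝ) else 0) else 0)) =
      ∑ x ∈ box (d + 1) Lc, ∑ b : Fin (d + 1),
        ((if b = ν then ((Lc : ℝ)⁻¹ * (Lc : ℝ)⁻¹) * ((((toSite x β % (Lc : ℤ) : ℤ) : ℝ) - ((Lc : ℝ) - 1) / 2)) else 0)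
          + (if b = β then (-(Lc : ℝ)⁻¹ * ((((toSite x ν % (Lc : ℤ) : ℤ) : ℝ) - ((Lc : ℝ) - 1) / 2))) * (if toSite x β % (Lc : ℤ) = (Lc : ℤ) - 1 then (1 : ℝ) else 0) else 0)) *
        ∑' s : Site (d + 1), ∑ b' : Fin (d + 1), E2 d Lc (j + 1) (toSite x) s (Sum.inl b) (Sum.inl b') *
          ((if b' = μ then ((Lc : ℝ)⁻¹ * (Lc : ℝ)⁻¹) * ((((s α % (Lc : ℤ) : ℤ) : ℝ) - ((Lc : ℝ) - 1) / 2)) else 0)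
            + (if b' = α then (-(Lc : ℝ)⁻¹ * ((((s μ % (Lc : ℤ) : ℤ) : ℝ) - ((Lc : ℝ) - 1) / 2))) * (if s α % (Lc : ℤ) = (Lc : ℤ) - 1 then (1 : ℝ) else 0) else 0)) := by
  have hLc : 1 ≤ Lc := one_le_of_neZero Lc
  -- cell adjointness with `p := q_{νβ}` (inside `E2`) and `Y := q_{μα}` (outside)
  have h := sum_box_E2apply_mul_periodic (d := d) (Lc := Lc) (j + 1) (N := Lc)
    (p := fun b' (s : Site (d + 1)) =>
      (if b' = ν then ((Lc : ℝ)⁻¹ * (Lc : ℝ)⁻¹) * ((((s β % (Lc : ℤ) : ℤ) : ℝ) - ((Lc : ℝ) - 1) / 2)) else 0)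
        + (if b' = β then (-(Lc : ℝ)⁻¹ * ((((s ν % (Lc : ℤ) : ℤ) : ℝ) - ((Lc : ℝ) - 1) / 2))) * (if s β % (Lc : ℤ) = (Lc : ℤ) - 1 then (1 : ℝ) else 0) else 0))
    (Y := fun b (x : Site (d + 1)) =>
      (if b = μ then ((Lc : ℝ)⁻¹ * (Lc : ℝ)⁻¹) * ((((x α % (Lc : ℤ) : ℤ) : ℝ) - ((Lc : ℝ) - 1) / 2)) else 0)
        + (if b = α then (-(Lc : ℝ)⁻¹ * ((((x μ % (Lc : ℤ) : ℤ) : ℝ) - ((Lc : ℝ) - 1) / 2))) * (if x α % (Lc : ℤ) = (Lc : ℤ) - 1 then (1 : ℝ) else 0) else 0))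
    (fun b' s t => qProfile_translate (Lc := Lc) ν β b' s t) (fun b x t => qProfile_translate (Lc := Lc) μ α b x t)
    (fun b' s => abs_qProfile_le (d := d) hLc ν β b' s) (fun b x => abs_qProfile_le (d := d) hLc μ α b x)
  -- the left side of `h` is our left side with the product commuted; its right side is our right side after `E2_swap`
  have hL : ∀ (x : Fin (d + 1) → ℕ) (a : Fin (d + 1)),
      (∑' y : Site (d + 1), ∑ b : Fin (d + 1), E2 d Lc (j + 1) (toSite x) y (Sum.inl a) (Sum.inl b) *
        ((if b = ν then ((Lc : ℝ)⁻¹ * (Lc : ℝ)⁻¹) * ((((y β % (Lc : ℤ) : ℤ) : ℝ) - ((Lc : ℝ) - 1) / 2)) else 0)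
          + (if b = β then (-(Lc : ℝ)⁻¹ * ((((y ν % (Lc : ℤ) : ℤ) : ℝ) - ((Lc : ℝ) - 1) / 2))) * (if y β % (Lc : ℤ) = (Lc : ℤ) - 1 then (1 : ℝ) else 0) else 0))) *
        ((if a = μ then ((Lc : ℝ)⁻¹ * (Lc : ℝ)⁻¹) * ((((toSite x α % (Lc : ℤ) : ℤ) : ℝ) - ((Lc : ℝ) - 1) / 2)) else 0)
          + (if a = α then (-(Lc : ℝ)⁻¹ * ((((toSite x μ % (Lc : ℤ) : ℤ) : ℝ) - ((Lc : ℝ) - 1) / 2))) * (if toSite x α % (Lc : ℤ) = (Lc : ℤ) - 1 then (1 : ℝ) else 0) else 0)) =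
      ((if a = μ then ((Lc : ℝ)⁻¹ * (Lc : ℝ)⁻¹) * ((((toSite x α % (Lc : ℤ) : ℤ) : ℝ) - ((Lc : ℝ) - 1) / 2)) else 0)
          + (if a = α then (-(Lc : ℝ)⁻¹ * ((((toSite x μ % (Lc : ℤ) : ℤ) : ℝ) - ((Lc : ℝ) - 1) / 2))) * (if toSite x α % (Lc : ℤ) = (Lc : ℤ) - 1 then (1 : ℝ) else 0) else 0)) *
        ∑' s : Site (d + 1), ∑ b' : Fin (d + 1), E2 d Lc (j + 1) (toSite x) s (Sum.inl a) (Sum.inl b') *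
          ((if b' = ν then ((Lc : ℝ)⁻¹ * (Lc : ℝ)⁻¹) * ((((s β % (Lc : ℤ) : ℤ) : ℝ) - ((Lc : ℝ) - 1) / 2)) else 0)
            + (if b' = β then (-(Lc : ℝ)⁻¹ * ((((s ν % (Lc : ℤ) : ℤ) : ℝ) - ((Lc : ℝ) - 1) / 2))) * (if s β % (Lc : ℤ) = (Lc : ℤ) - 1 then (1 : ℝ) else 0) else 0)) :=
    fun x a => mul_comm _ _
  have hR : ∀ (r : Fin (d + 1) → ℕ) (b : Fin (d + 1)),
      (∑' x : Site (d + 1), ∑ a : Fin (d + 1), E2 d Lc (j + 1) x (toSite r) (Sum.inl a) (Sum.inl b) *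
        ((if a = μ then ((Lc : ℝ)⁻¹ * (Lc : ℝ)⁻¹) * ((((x α % (Lc : ℤ) : ℤ) : ℝ) - ((Lc : ℝ) - 1) / 2)) else 0)
          + (if a = α then (-(Lc : ℝ)⁻¹ * ((((x μ % (Lc : ℤ) : ℤ) : ℝ) - ((Lc : ℝ) - 1) / 2))) * (if x α % (Lc : ℤ) = (Lc : ℤ) - 1 then (1 : ℝ) else 0) else 0))) =
      ∑' s : Site (d + 1), ∑ b' : Fin (d + 1), E2 d Lc (j + 1) (toSite r) s (Sum.inl b) (Sum.inl b') *
          ((if b' = μ then ((Lc : ℝ)⁻¹ * (Lc : ℝ)⁻¹) * ((((s α % (Lc : ℤ) : ℤ) : ℝ) - ((Lc : ℝ) - 1) / 2)) else 0)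
            + (if b' = α then (-(Lc : ℝ)⁻¹ * ((((s μ % (Lc : ℤ) : ℤ) : ℝ) - ((Lc : ℝ) - 1) / 2))) * (if s α % (Lc : ℤ) = (Lc : ℤ) - 1 then (1 : ℝ) else 0) else 0)) :=
    fun r b => tsum_congr fun x => Finset.sum_congr rfl fun a _ => by rw [E2_swap (Lc := Lc) (j + 1) (toSite r) x a b]
  simp_rw [hL, hR] at h
  exact h

/-- [folklore] **THE PATTERN TABLE IS ANTISYMMETRIC IN THE RIGHT PAIR** (`ν ≠ β`): `P(μα;νβ) = −P(μα;βν)`. -/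
theorem pairing_antisymm_right (j : ℕ) (μ α : Fin (d + 1)) {ν β : Fin (d + 1)} (hνβ : ν ≠ β) :
    ∑ x ∈ box (d + 1) Lc, ∑ b : Fin (d + 1),
        ((if b = μ then ((Lc : ℝ)⁻¹ * (Lc : ℝ)⁻¹) * ((((toSite x α % (Lc : ℤ) : ℤ) : ℝ) - ((Lc : ℝ) - 1) / 2)) else 0)
          + (if b = α then (-(Lc : ℝ)⁻¹ * ((((toSite x μ % (Lc : ℤ) : ℤ) : ℝ) - ((Lc : ℝ) - 1) / 2))) * (if toSite x α % (Lc : ℤ) = (Lc : ℤ) - 1 then (1 : ℝ) else 0) else 0)) *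
        ∑' s : Site (d + 1), ∑ b' : Fin (d + 1), E2 d Lc (j + 1) (toSite x) s (Sum.inl b) (Sum.inl b') *
          ((if b' = ν then ((Lc : ℝ)⁻¹ * (Lc : ℝ)⁻¹) * ((((s β % (Lc : ℤ) : ℤ) : ℝ) - ((Lc : ℝ) - 1) / 2)) else 0)
            + (if b' = β then (-(Lc : ℝ)⁻¹ * ((((s ν % (Lc : ℤ) : ℤ) : ℝ) - ((Lc : ℝ) - 1) / 2))) * (if s β % (Lc : ℤ) = (Lc : ℤ) - 1 then (1 : ℝ) else 0) else 0)) =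
      -∑ x ∈ box (d + 1) Lc, ∑ b : Fin (d + 1),
        ((if b = μ then ((Lc : ℝ)⁻¹ * (Lc : ℝ)⁻¹) * ((((toSite x α % (Lc : ℤ) : ℤ) : ℝ) - ((Lc : ℝ) - 1) / 2)) else 0)
          + (if b = α then (-(Lc : ℝ)⁻¹ * ((((toSite x μ % (Lc : ℤ) : ℤ) : ℝ) - ((Lc : ℝ) - 1) / 2))) * (if toSite x α % (Lc : ℤ) = (Lc : ℤ) - 1 then (1 : ℝ) else 0) else 0)) *
        ∑' s : Site (d + 1), ∑ b' : Fin (d + 1), E2 d Lc (j + 1) (toSite x) s (Sum.inl b) (Sum.inl b') *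
          ((if b' = β then ((Lc : ℝ)⁻¹ * (Lc : ℝ)⁻¹) * ((((s ν % (Lc : ℤ) : ℤ) : ℝ) - ((Lc : ℝ) - 1) / 2)) else 0)
            + (if b' = ν then (-(Lc : ℝ)⁻¹ * ((((s β % (Lc : ℤ) : ℤ) : ℝ) - ((Lc : ℝ) - 1) / 2))) * (if s ν % (Lc : ℤ) = (Lc : ℤ) - 1 then (1 : ℝ) else 0) else 0)) := by
  rw [← Finset.sum_neg_distrib]
  refine Finset.sum_congr rfl fun x _ => ?_
  rw [← Finset.sum_neg_distrib]
  refine Finset.sum_congr rfl fun b _ => ?_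
  rw [tsum_E2_qProfile_antisymm (Lc := Lc) j hνβ (toSite x) b]
  ring

/-- [folklore] **THE PATTERN TABLE IS ANTISYMMETRIC IN THE LEFT PAIR** (`μ ≠ α`): `P(μα;νβ) = −P(αμ;νβ)` (pair swap, right antisymmetry, pair swap). -/
theorem pairing_antisymm_left (j : ℕ) {μ α : Fin (d + 1)} (hμα : μ ≠ α) (ν β : Fin (d + 1)) :
    ∑ x ∈ box (d + 1) Lc, ∑ b : Fin (d + 1),
        ((if b = μ then ((Lc : ℝ)⁻¹ * (Lc : ℝ)⁻¹) * ((((toSite x α % (Lc : ℤ) : ℤ) : ℝ) - ((Lc : ℝ) - 1) / 2)) else 0)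
          + (if b = α then (-(Lc : ℝ)⁻¹ * ((((toSite x μ % (Lc : ℤ) : ℤ) : ℝ) - ((Lc : ℝ) - 1) / 2))) * (if toSite x α % (Lc : ℤ) = (Lc : ℤ) - 1 then (1 : ℝ) else 0) else 0)) *
        ∑' s : Site (d + 1), ∑ b' : Fin (d + 1), E2 d Lc (j + 1) (toSite x) s (Sum.inl b) (Sum.inl b') *
          ((if b' = ν then ((Lc : ℝ)⁻¹ * (Lc : ℝ)⁻¹) * ((((s β % (Lc : ℤ) : ℤ) : ℝ) - ((Lc : ℝ) - 1) / 2)) else 0)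
            + (if b' = β then (-(Lc : ℝ)⁻¹ * ((((s ν % (Lc : ℤ) : ℤ) : ℝ) - ((Lc : ℝ) - 1) / 2))) * (if s β % (Lc : ℤ) = (Lc : ℤ) - 1 then (1 : ℝ) else 0) else 0)) =
      -∑ x ∈ box (d + 1) Lc, ∑ b : Fin (d + 1),
        ((if b = α then ((Lc : ℝ)⁻¹ * (Lc : ℝ)⁻¹) * ((((toSite x μ % (Lc : ℤ) : ℤ) : ℝ) - ((Lc : ℝ) - 1) / 2)) else 0)
          + (if b = μ then (-(Lc : ℝ)⁻¹ * ((((toSite x α % (Lc : ℤ) : ℤ) : ℝ) - ((Lc : ℝ) - 1) / 2))) * (if toSite x μ % (Lc : ℤ) = (Lc : ℤ) - 1 then (1 : ℝ) else 0) else 0)) *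
        ∑' s : Site (d + 1), ∑ b' : Fin (d + 1), E2 d Lc (j + 1) (toSite x) s (Sum.inl b) (Sum.inl b') *
          ((if b' = ν then ((Lc : ℝ)⁻¹ * (Lc : ℝ)⁻¹) * ((((s β % (Lc : ℤ) : ℤ) : ℝ) - ((Lc : ℝ) - 1) / 2)) else 0)
            + (if b' = β then (-(Lc : ℝ)⁻¹ * ((((s ν % (Lc : ℤ) : ℤ) : ℝ) - ((Lc : ℝ) - 1) / 2))) * (if s β % (Lc : ℤ) = (Lc : ℤ) - 1 then (1 : ℝ) else 0) else 0)) := by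
  rw [pairing_swap (Lc := Lc) j μ α ν β, pairing_antisymm_right (Lc := Lc) j ν β hμα, pairing_swap (Lc := Lc) j ν β α μ]

end Summit.QuantumFields.BalabanUV.Beta.GAN24.ExchangeESectorPattern

end
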